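import Summits.QuantumFields.YangMills.Theorems.BalabanUVNodesN09OnDomainProvisoOfGeometricChartData

/-!
# NODE N09 · THE PRODUCER-FACING EDITION: the A-free chart regularity of the (F1) tower (`hconf ∕ hΦV ∕ hJV ∕ hΦc ∕ hJpos`) DERIVED from JOINT CONTINUITY of `(Φ, J)` on
# `domAlt_{j+1} ×ˢ S` with a COMPACT fibre support `S` confined in `domAlt_j` — the literal shape of [I]'s (2.10) substitution (continuous on domain × closed box)

Cell `pub-ymgap` (YM-PLAN Track A), DAG node N09 [Balaban1987RG1] (= [I]); seat `pub-ymgap-dag-n09-w1` g5 (D-0149 width seat 1 of node N09), FILE 7; count-neutral K1-face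
helper keyed to K1⁹ `StabilityBRunRowsAtRecordR13SepCoPHV` = stmt-QuantumFields-27364 (KEY MAP v2; `--kind proof --supports … --as helper`).  HONEST FRAMING: kernel topology BY NAME (Mathlib's
generalized tube lemma) over FILE 5; NOTHING of Bałaban's analysis asserted; every chart datum DISPLAYED ((M3r) stays UNOWNED); N09 NOT discharged; K0⁷∕K1⁹∕K3⁸ NOT closed; counts
unmoved (typed 28∕28 · discharged 5∕27); one finite 𝕋⁴ programme at fixed ε — R4 closes the conditional rung `BalabanLadder.UV` only; the Yang–Mills mass gap (Clay) is NOT proved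
by any of this; nothing continuum ∕ ℝ⁴ ∕ OS.

WHY.  FILE 5 (`…N09RegularityTowerOfGeometricChartData`) reads, per step, the chart sockets `hΦ hJ havgΦ hmap`, the base point `hz₀`, the fibre-nullity `hnull`, N07's `hcrit`, and FIVE
regularity binders stated in the exact a.e.∕filter currency the dominated-convergence engine consumes: `hconf` (local bound + compact confinement), `hΦV`, `hJV` (a.e.-`z`
continuity in the coarse field), `hΦc` (continuity in `z` at the base point), `hJpos` (`J > 0` near the base point).  For [I]'s (2.10) chart these five are ONE fact: the
substitution `(W, B₁) ↦ exp(i(B₁ + hD_W B₁))·V^{(k)}(W)` and its density are JOINTLY CONTINUOUS on «regular `W`» × «the closed box `|B₁| ≤ ε₁`», the box is compact, carries the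
fibre measure, contains `B₁ = 0` in its interior with positive density there, and the image lies in the current small-field domain (threshold hierarchy).  THIS FILE proves that
reduction once, generically: §1 the tube-lemma confinement (`V₀ ∈ U` open, `S` compact, `Φ` continuous on `U ×ˢ S` into the open `D` ⇒ a closed — hence compact, the coarse
space being compact — neighbourhood `K ⊆ U` of `V₀` with `Φ '' (K ×ˢ S)` compact `⊆ D`); §2 the five binders; §3 FILE 5's door with them replaced.

WHAT IS PROVED (theorems only; 0 def; 0 sorry; axioms standard).
* §1 `exists_closed_nhds_image_prod_subset` (generic: compact regular `X`, any `Z`).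
* §2 ★★ `hconf_of_jointContinuity` · `hΦV_of_jointContinuity` · `hJV_of_jointContinuity` · `hΦc_of_jointContinuity` · `hJpos_of_jointContinuity` (FILE 2's binder shapes verbatim, at
  any step `k`, from: `S` compact with `τ Sᶜ = 0`, `τ S < ∞`; `Φ`, `J` continuous on `U ×ˢ S`; `Φ (U ×ˢ S) ⊆ D`; `S ∈ 𝓝 (z₀ V)`; `0 < J (V, z₀ V)`).
* §3 ★★★ `thm3Member_stage13SepCoPH_atDomAlt_of_jointlyContinuousCharts_of_numerics_of_εreg_eq` (dag-n09-w4 g3's door ∕ FILE 5's, the five regularity binders replaced by joint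
  continuity + compact confined support + interior base point with positive density).

HONEST SCOPE.  The chart sockets `hΦ hJ havgΦ hmap`, the base point `hz₀`, the fibre-nullity `hnull`, N07's `hcrit` ∕ `hsolν`, (I19) `hint`, `hcov`, [B11] ×3 and the numerics stay
DISPLAYED; nothing of FILES 1–6 re-proved.
-/

noncomputable section

open MeasureTheory Set Filter Topology
open scoped ENNReal NNReal
open Literature.MathematicalPhysics.QuantumFieldTheory
open Literature.MathematicalPhysics.QuantumFieldTheory.Balaban1983to89
open Literature.MathematicalPhysics.QuantumFieldTheory.Balaban1983to89.Node00
open Literature.MathematicalPhysics.QuantumFieldTheory.Balaban1983to89.T4Continuum (T4Family)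
open Literature.MathematicalPhysics.QuantumFieldTheory.Balaban1983to89.DagBinding (WorldP leavesP)
open Literature.MathematicalPhysics.QuantumFieldTheory.Balaban1983to89.B12RTGaugeInvariance254 (liftTransf)
open Literature.MathematicalPhysics.QuantumFieldTheory.Balaban1983to89.GaugeField (gaugeAct)
open Literature.MathematicalPhysics.QuantumFieldTheory.Balaban1983to89.ExpMeanLog (deltaSU)
open Literature.MathematicalPhysics.QuantumFieldTheory.Balaban1983to89.FederbushMean (deltaFed)
open Summit.QuantumFields.YangMills.BalabanUVNodes.N09RegularityTowerOfGeometricChartData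
  (thm3Member_stage13SepCoPH_atDomAlt_of_geometricChartData_of_numerics_of_εreg_eq)

namespace Summit.QuantumFields.YangMills.BalabanUVNodes.N09ChartRegularityOfJointContinuity

/-! ## §1 Generic topology: the tube-lemma confinement in a compact regular coarse space -/

section Tube

variable {X Z Y : Type*} [TopologicalSpace X] [CompactSpace X] [RegularSpace X] [TopologicalSpace Z] [TopologicalSpace Y]

/-- **THE TUBE-LEMMA CONFINEMENT.**  `U ⊆ X` open in a compact regular space, `S ⊆ Z` compact, `Φ` continuous on `U ×ˢ S` with `Φ (U ×ˢ S) ⊆ D`: every `V₀ ∈ U` has a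
CLOSED (hence compact) neighbourhood `K ⊆ U` such that `Φ '' (K ×ˢ S)` is a compact subset of `D` containing `Φ (V, z)` for all `V ∈ K`, `z ∈ S` (no openness of `D` needed).
[cite: Balaban1987RG1, (2.10) p.267 (bookkeeping)] -/
theorem exists_closed_nhds_image_prod_subset {U : Set X} (hU : IsOpen U) {S : Set Z} (hS : IsCompact S) {Φ : X × Z → Y} (hΦ : ContinuousOn Φ (U ×ˢ S))
    {D : Set Y} (hΦD : ∀ V ∈ U, ∀ z ∈ S, Φ (V, z) ∈ D) {V₀ : X} (hV₀ : V₀ ∈ U) :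
    ∃ K : Set X, K ∈ 𝓝 V₀ ∧ IsCompact K ∧ K ⊆ U ∧ IsCompact (Φ '' (K ×ˢ S)) ∧ Φ '' (K ×ˢ S) ⊆ D := by
  obtain ⟨K, hK, hKc, hKU⟩ := exists_mem_nhds_isClosed_subset (hU.mem_nhds hV₀)
  have hKcpt : IsCompact K := hKc.isCompact
  have hsub : K ×ˢ S ⊆ U ×ˢ S := Set.prod_mono hKU Subset.rfl
  refine ⟨K, hK, hKcpt, hKU, (hKcpt.prod hS).image_of_continuousOn (hΦ.mono hsub), ?_⟩
  rintro _ ⟨⟨V, z⟩, ⟨hV, hz⟩, rfl⟩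
  exact hΦD V (hKU hV) z hz

end Tube

/-! ## §2 The five regularity binders of the (F1) tower from joint continuity on `U ×ˢ S`, `S` a compact confined fibre support -/

section Binders

variable {F : T4Family} {N : ℕ} {K k : ℕ}
  {Z : Type*} [TopologicalSpace Z] [MeasurableSpace Z] {τ : Measure Z} {S : Set Z}
  {Φ : (PBond (F.P K) (k + 1) → SU N) × Z → GaugeField (F.P K) k (SU N)} {J : (PBond (F.P K) (k + 1) → SU N) × Z → ℝ≥0}
  {U : Set (PBond (F.P K) (k + 1) → SU N)} {D : Set (GaugeField (F.P K) k (SU N))}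

/-- **★★ `hconf` FROM JOINT CONTINUITY**: `S` compact with `τ Sᶜ = 0` and `τ S < ∞`, `Φ` and `J` continuous on `U ×ˢ S` (`U` open), `Φ (U ×ˢ S) ⊆ D` ⇒ at every `V₀ ∈ U`
there are a compact `C ⊆ D` and a `τ`-integrable bound dominating `J (V, ·)` with `Φ (V, ·) ∈ C` a.e., for all `V` near `V₀` within `U` — FILE 2's `hconf` verbatim (bound
`= max_{K ×ˢ S} J` on `S`, `0` off it; `C = Φ '' (K ×ˢ S)`, §1). [cite: Balaban1987RG1, (2.10) p.267 (bookkeeping)] -/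
theorem hconf_of_jointContinuity (hU : IsOpen U) (hS : IsCompact S) (hSm : MeasurableSet S) (hτS : τ Sᶜ = 0) (hτfin : τ S < ∞)
    (hΦ : ContinuousOn Φ (U ×ˢ S)) (hJ : ContinuousOn (fun p => (J p : ℝ)) (U ×ˢ S)) (hΦD : ∀ V ∈ U, ∀ z ∈ S, Φ (V, z) ∈ D) :
    ∀ V₀ ∈ U, ∃ C ⊆ D, IsCompact C ∧ ∃ bound : Z → ℝ, Integrable bound τ ∧
      ∀ᶠ V in 𝓝[U] V₀, ∀ᵐ z ∂τ, (J (V, z) : ℝ) ≤ bound z ∧ Φ (V, z) ∈ C := by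
  intro V₀ hV₀
  obtain ⟨K₀, hK₀, hK₀c, hK₀U, hCc, hCD⟩ := exists_closed_nhds_image_prod_subset hU hS hΦ hΦD hV₀
  -- a uniform bound for `J` on the compact `K₀ ×ˢ S`
  have hsub : K₀ ×ˢ S ⊆ U ×ˢ S := Set.prod_mono hK₀U Subset.rfl
  obtain ⟨M, hM⟩ : ∃ M : ℝ, ∀ p ∈ K₀ ×ˢ S, (J p : ℝ) ≤ M := by
    rcases (K₀ ×ˢ S).eq_empty_or_nonempty with he | hne
    · exact ⟨0, fun p hp => by simp [he] at hp⟩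
    · obtain ⟨p₀, _, hmax⟩ := (hK₀c.prod hS).exists_isMaxOn hne (hJ.mono hsub)
      exact ⟨(J p₀ : ℝ), fun p hp => hmax hp⟩
  refine ⟨Φ '' (K₀ ×ˢ S), hCD, hCc, S.indicator (fun _ => M), ?_, ?_⟩
  · exact (integrable_indicator_iff hSm).2 (integrableOn_const hτfin.ne)
  · have hae : ∀ᵐ z ∂τ, z ∈ S := by
      rw [ae_iff]; exact hτS
    filter_upwards [mem_nhdsWithin_of_mem_nhds hK₀] with V hV
    filter_upwards [hae] with z hz
    refine ⟨?_, ⟨(V, z), ⟨hV, hz⟩, rfl⟩⟩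
    rw [Set.indicator_of_mem hz]
    exact hM (V, z) ⟨hV, hz⟩

/-- **`hΦV` FROM JOINT CONTINUITY**: for `τ`-a.e. `z` (namely `z ∈ S`) the map `V ↦ Φ (V, z)` is continuous at `V₀` within `U`. [cite: Balaban1987RG1, (2.10) p.267 (bookkeeping)] -/
theorem hΦV_of_jointContinuity (hτS : τ Sᶜ = 0) (hΦ : ContinuousOn Φ (U ×ˢ S)) :
    ∀ V₀ ∈ U, ∀ᵐ z ∂τ, ContinuousWithinAt (fun V => Φ (V, z)) U V₀ := by
  intro V₀ hV₀
  have hae : ∀ᵐ z ∂τ, z ∈ S := by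
    rw [ae_iff]; exact hτS
  filter_upwards [hae] with z hz
  have h := hΦ (V₀, z) ⟨hV₀, hz⟩
  exact h.comp (f := fun V => (V, z)) (continuousWithinAt_id.prodMk continuousWithinAt_const) fun V hV => ⟨hV, hz⟩

/-- **`hJV` FROM JOINT CONTINUITY**: for `τ`-a.e. `z` the map `V ↦ J (V, z)` is continuous at `V₀` within `U`. [cite: Balaban1987RG1, (2.10) p.267 (bookkeeping)] -/
theorem hJV_of_jointContinuity (hτS : τ Sᶜ = 0) (hJ : ContinuousOn (fun p => (J p : ℝ)) (U ×ˢ S)) :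
    ∀ V₀ ∈ U, ∀ᵐ z ∂τ, ContinuousWithinAt (fun V => (J (V, z) : ℝ)) U V₀ := by
  intro V₀ hV₀
  have hae : ∀ᵐ z ∂τ, z ∈ S := by
    rw [ae_iff]; exact hτS
  filter_upwards [hae] with z hz
  have h := hJ (V₀, z) ⟨hV₀, hz⟩
  exact h.comp (f := fun V => (V, z)) (continuousWithinAt_id.prodMk continuousWithinAt_const) fun V hV => ⟨hV, hz⟩

omit [MeasurableSpace Z] in
/-- **`hΦc` FROM JOINT CONTINUITY**: if the base point `z₀ V` lies in the INTERIOR of the support (`S ∈ 𝓝 (z₀ V)`), `z ↦ Φ (V, z)` is continuous at `z₀ V`.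
[cite: Balaban1987RG1, (2.10) p.267 (bookkeeping)] -/
theorem hΦc_of_jointContinuity (hΦ : ContinuousOn Φ (U ×ˢ S)) {z₀ : (PBond (F.P K) (k + 1) → SU N) → Z} (hz₀S : ∀ V ∈ U, S ∈ 𝓝 (z₀ V)) :
    ∀ V ∈ U, ContinuousAt (fun z => Φ (V, z)) (z₀ V) := by
  intro V hV
  have hmem : z₀ V ∈ S := mem_of_mem_nhds (hz₀S V hV)
  have h := hΦ (V, z₀ V) ⟨hV, hmem⟩
  have h' : ContinuousWithinAt (fun z => Φ (V, z)) S (z₀ V) :=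
    h.comp (f := fun z => (V, z)) (continuousWithinAt_const.prodMk continuousWithinAt_id) fun z hz => ⟨hV, hz⟩
  exact h'.continuousAt (hz₀S V hV)

omit [MeasurableSpace Z] in
/-- **`hJpos` FROM JOINT CONTINUITY**: if moreover `0 < J (V, z₀ V)`, then `J (V, ·) > 0` near `z₀ V`. [cite: Balaban1987RG1, (2.10) p.267 (bookkeeping)] -/
theorem hJpos_of_jointContinuity (hJ : ContinuousOn (fun p => (J p : ℝ)) (U ×ˢ S)) {z₀ : (PBond (F.P K) (k + 1) → SU N) → Z}
    (hz₀S : ∀ V ∈ U, S ∈ 𝓝 (z₀ V)) (hJ0 : ∀ V ∈ U, 0 < J (V, z₀ V)) :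
    ∀ V ∈ U, ∀ᶠ z in 𝓝 (z₀ V), 0 < J (V, z) := by
  intro V hV
  have hmem : z₀ V ∈ S := mem_of_mem_nhds (hz₀S V hV)
  have h := hJ (V, z₀ V) ⟨hV, hmem⟩
  have h' : ContinuousWithinAt (fun z => (J (V, z) : ℝ)) S (z₀ V) :=
    h.comp (f := fun z => (V, z)) (continuousWithinAt_const.prodMk continuousWithinAt_id) fun z hz => ⟨hV, hz⟩
  have hc : ContinuousAt (fun z => (J (V, z) : ℝ)) (z₀ V) := h'.continuousAt (hz₀S V hV)
  have hpos : (0 : ℝ) < J (V, z₀ V) := NNReal.coe_pos.2 (hJ0 V hV)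
  filter_upwards [hc.eventually (lt_mem_nhds hpos)] with z hz
  exact NNReal.coe_pos.1 hz

end Binders

/-! ## §3 dag-n09-w4 g3's door ∕ FILE 5's, with the five regularity binders replaced by JOINT CONTINUITY on `domAlt_{j+1} ×ˢ S_j` -/

section Door

variable {F : T4Family} {N : ℕ} [NeZero N]
  (θ : Stage13HParams F N) (h : θ.Provisos₁₃SepCoPH F N) {w : WorldP} (P : B12.RunParams)
  {Z : ℕ → Type*} [∀ j, TopologicalSpace (Z j)] [∀ j, MeasurableSpace (Z j)] (τ : ∀ j, Measure (Z j)) [∀ j, SFinite (τ j)] [∀ j, (τ j).IsOpenPosMeasure]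
  (S : ∀ j, Set (Z j))
  (Φ : ∀ j, (PBond (F.P P.K) (j + 1) → SU N) × Z j → GaugeField (F.P P.K) j (SU N))
  (J : ∀ j, (PBond (F.P P.K) (j + 1) → SU N) × Z j → ℝ≥0)
  (z₀ : ∀ j, (PBond (F.P P.K) (j + 1) → SU N) → Z j)

/-- **★★★ N09's THEOREM-3 MEMBER AT THE STAGE-13 RECORD FROM JOINTLY CONTINUOUS, COMPACTLY SUPPORTED, CONFINED CHARTS** (FILE 5's
`thm3Member_stage13SepCoPH_atDomAlt_of_geometricChartData_of_numerics_of_εreg_eq` with `hconf hΦV hJV hΦc hJpos := §2`): per step `j < P.K`, a compact measurable fibre support `S j`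
carrying `τ j` (`τ j (S j)ᶜ = 0`, `τ j (S j) < ∞`), `Φ j` and `J j` JOINTLY CONTINUOUS on `domAlt_{j+1} ×ˢ S j`, the image confined in `domAlt_j`, the base point `z₀ j V` INTERIOR to
`S j` with `J j (V, z₀ j V) > 0`; plus the sockets `hΦ hJ havgΦ hmap`, `hz₀`, `hnull`, N07's `hcrit` ∕ `hsolν`, (I19) `hint`, `hcov`, [B11] ×3 and NUMERICS — print's (2.10) chart in the
form its producer will state it.  CONDITIONAL; nothing of Bałaban's asserted; N09 NOT discharged.
[cite: Balaban1987RG1, Thm 3 p.264, p.259, (0.11) p.253, (0.19) p.255, (2.9) p.266, (2.10) p.267; Balaban1985Variational, Thm 1 (8)–(10) p.279 and (181) p.307] -/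
theorem thm3Member_stage13SepCoPH_atDomAlt_of_jointlyContinuousCharts_of_numerics_of_εreg_eq
    (hC : w.C = (datumOfRecord₁₃SepCoPH F N θ h).C) (hε : 0 < θ.ε₂₉) (heq : θ.toStage13Params.ν.εreg = θ.εbg)
    (hεreg : 0 < θ.toStage13Params.ν.εreg) (hε₀ : 0 ≤ θ.toStage13Params.ν.ε₀)
    (hnumF : ((((F.P P.K).d * (F.P P.K).L : ℕ) : ℝ)) ^ 2 / 4 * θ.toStage13Params.ν.ε₀ < deltaFed (Fin N))
    (hε3 : (143 * (((((F.P P.K).d + 4 : ℕ) : ℝ)) ^ 2 / 4) ^ 2) * θ.toStage13Params.ν.εreg ≤ 1 / 3)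
    (hε2 : 2 * θ.toStage13Params.ν.εreg ≤ 2 * deltaSU (Fin N) / ((((F.P P.K).d + 4) * (F.P P.K).L : ℕ) : ℝ) ^ 2)
    (hord : 2 * θ.toStage13Params.ν.εreg / ((F.P P.K).L : ℝ) ^ 2 +
      4 * max θ.toStage13Params.ε₂₉ (10 * (((((F.P P.K).d + 2) * (F.P P.K).L : ℕ) : ℝ) * θ.toStage13Params.ε₂₉) * ((F.P P.K).L : ℝ) ^ ((F.P P.K).d - 1)) ≤
        θ.toStage13Params.ν.ε₀)
    (hn1 : 1640 * (2 * (((((F.P P.K).d + 2) * (F.P P.K).L : ℕ) : ℝ) * θ.toStage13Params.ε₂₉) +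
        ((((F.P P.K).d + 2) * (F.P P.K).L : ℕ) : ℝ) ^ 2 / 4 * (2 * θ.toStage13Params.ν.εreg / ((F.P P.K).L : ℝ) ^ 2)) *
          (((F.P P.K).L : ℝ) ^ ((F.P P.K).d - 1)) ^ 2 ≤ 1)
    (hn2 : 13 * (2 * (((((F.P P.K).d + 2) * (F.P P.K).L : ℕ) : ℝ) * θ.toStage13Params.ε₂₉) +
        ((((F.P P.K).d + 2) * (F.P P.K).L : ℕ) : ℝ) ^ 2 / 4 * (2 * θ.toStage13Params.ν.εreg / ((F.P P.K).L : ℝ) ^ 2)) *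
          ((F.P P.K).L : ℝ) ^ ((F.P P.K).d - 1) < deltaSU (Fin N))
    (hcov : ∀ j < P.K, ∀ (v : GaugeTransf (F.P P.K) (j + 1) (SU N)) (W : GaugeField (F.P P.K) (j + 1) (SU N)),
      UkExists F N P.K (j + 1) θ.toStage13Params.ν.εreg W →
        critCfgOfRecord F N θ.toStage13Params.ν P.K j (gaugeAct v W) = gaugeAct (liftTransf v) (critCfgOfRecord F N θ.toStage13Params.ν P.K j W))
    (hsolν : ∀ j < P.K, ∀ W ∈ domAltOfRecord F N θ.ν P.K (j + 1), UkExists F N P.K (j + 1) θ.toStage13Params.ν.εreg W)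
    (hint : ∀ j < P.K, Integrable (betaInputOfRecord F N (TβOfRecord₁₃ F N) (chiβOfRecord₁₃ F N θ.toStage13Params) P.K (gOfRecord₁₃ F N θ.toStage13Params P) j)
      (fieldMeasure (F.P P.K) j (SU N)))
    (hSc : ∀ j, IsCompact (S j)) (hSm : ∀ j, MeasurableSet (S j)) (hτS : ∀ j, τ j (S j)ᶜ = 0) (hτfin : ∀ j, τ j (S j) < ∞)
    (hΦ : ∀ j, Measurable (Φ j)) (hJ : ∀ j, Measurable (J j))
    (hΦcont : ∀ j < P.K, ContinuousOn (Φ j) (domAltOfRecord F N θ.ν P.K (j + 1) ×ˢ S j))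
    (hJcont : ∀ j < P.K, ContinuousOn (fun p => (J j p : ℝ)) (domAltOfRecord F N θ.ν P.K (j + 1) ×ˢ S j))
    (hΦD : ∀ j < P.K, ∀ V ∈ domAltOfRecord F N θ.ν P.K (j + 1), ∀ z ∈ S j, Φ j (V, z) ∈ domAltOfRecord F N θ.ν P.K j)
    (havgΦ : ∀ j < P.K, ∀ V ∈ domAltOfRecord F N θ.ν P.K (j + 1), ∀ z, (avOfRecord F N P.K j).avg (Φ j (V, z)) = V)
    (hmap : ∀ j < P.K, (fieldMeasure (F.P P.K) j (SU N)).restrict ((avOfRecord F N P.K j).avg ⁻¹' domAltOfRecord F N θ.ν P.K (j + 1) ∩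
        {U | chiβOfRecord₁₃ F N θ.toStage13Params P.K (gOfRecord₁₃ F N θ.toStage13Params P) j U ≠ 0})
      = ((((piHaar (F.P P.K) (j + 1) (SU N)).restrict (domAltOfRecord F N θ.ν P.K (j + 1))).prod (τ j)).withDensity
          (fun p => (J j p : ℝ≥0∞))).map (Φ j))
    (hcrit : ∀ j < P.K, ContinuousOn (critCfgOfRecord F N θ.toStage13Params.ν P.K j) (domAltOfRecord F N θ.ν P.K (j + 1)))
    (hnull : ∀ j < P.K, ∀ V₀ ∈ domAltOfRecord F N θ.ν P.K (j + 1), ∀ b : PBond (F.P P.K) j, ¬ IsB0 b →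
      τ j {z | fluctDevOfRecord F N θ.toStage13Params.ν P.K j (Φ j (V₀, z)) b = θ.toStage13Params.ε₂₉} = 0)
    (hz₀ : ∀ j < P.K, ∀ V ∈ domAltOfRecord F N θ.ν P.K (j + 1), Φ j (V, z₀ j V) = critCfgOfRecord F N θ.toStage13Params.ν P.K j V)
    (hz₀S : ∀ j < P.K, ∀ V ∈ domAltOfRecord F N θ.ν P.K (j + 1), S j ∈ 𝓝 (z₀ j V))
    (hJ0 : ∀ j < P.K, ∀ V ∈ domAltOfRecord F N θ.ν P.K (j + 1), 0 < J j (V, z₀ j V))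
    (h11 : ∀ k, k ≤ P.K → ∀ V ∈ domAltOfRecord F N θ.ν P.K k, UkExists F N P.K k θ.εbg V ∧ UniqueUkOrbit F N P.K k θ.εbg V)
    (hres : ∀ k, k ≤ P.K → HRestrict F N θ.εbg P.K k (domAltOfRecord F N θ.ν P.K k))
    (huniq : ∀ k, k ≤ P.K → ∀ V ∈ domAltOfRecord F N θ.ν P.K k, ∀ j < k,
      UniqueUkOrbit F N P.K (j + 1) θ.εbg (Averaging.iter (avOfRecord F N P.K) (j + 1) (Uk F N P.K k θ.εbg V))) :
    (leavesP w P).smallCouplings → (leavesP w P).smallFieldInductive :=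
  thm3Member_stage13SepCoPH_atDomAlt_of_geometricChartData_of_numerics_of_εreg_eq θ h P τ Φ J z₀ hC hε heq hεreg hε₀ hnumF hε3 hε2 hord hn1 hn2 hcov hsolν hint hΦ hJ
    havgΦ hmap
    (fun j hj => hconf_of_jointContinuity (B12ContinuousTransportInvarianceOn.isOpen_domAltOfRecord θ.ν P.K (j + 1))
      (hSc j) (hSm j) (hτS j) (hτfin j) (hΦcont j hj) (hJcont j hj) (hΦD j hj))
    (fun j hj => hΦV_of_jointContinuity (hτS j) (hΦcont j hj))
    (fun j hj => hJV_of_jointContinuity (hτS j) (hJcont j hj))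
    hcrit hnull hz₀
    (fun j hj => hΦc_of_jointContinuity (hΦcont j hj) (hz₀S j hj))
    (fun j hj => hJpos_of_jointContinuity (hJcont j hj) (hz₀S j hj) (hJ0 j hj))
    h11 hres huniq

end Door

end Summit.QuantumFields.YangMills.BalabanUVNodes.N09ChartRegularityOfJointContinuity

end
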